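import Mathlib.Analysis.Normed.Operator.Basic
import Mathlib.Analysis.SpecificLimits.Normed
import Mathlib.Algebra.BigOperators.NatAntidiagonal
import Mathlib.Analysis.Complex.Basic
import HarnessLib

/-!
# Lyapunov–Perron sums: the two weighted convolution estimates

Analysis/OperatorTheory proofs-layer file (theorems only, no definitions, no named facts).

The discrete Lyapunov–Perron operator of a linear map `m` with an exponential dichotomy
(`‖mⁱ P‖ ≤ C aⁱ` forward on the range of a projection `P`, `‖J i‖ bⁱ ≤ C` for a backward family
`J` on its kernel, `a < b`) acting on sequences `g` with `‖g k‖ ≤ t γᵏ`, `a < γ < b`, consists of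
the "stable" finite convolution `∑_{i+j=n} mⁱ P g_j` and the "unstable" tail
`∑_{i ≥ 0} J_{i+1} Q g_{k+i}`. This file records the two geometric-series estimates

* `norm_sum_antidiagonal_le`: `‖∑_{i+j=n} (mⁱ P)(g j)‖ ≤ C (1 − a/γ)⁻¹ t γⁿ`;
* `summable_backward_tail`, `norm_tsum_backward_tail_le`:
  the tail is summable and `‖∑' i, (J (i+1) Q)(g (k+i))‖ ≤ C² b⁻¹ (1 − γ/b)⁻¹ t γᵏ`,

which make the Lyapunov–Perron operator a contraction of the `γ`-weighted sup-norm ball (Henry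
1981, §5.2 / Hirsch–Pugh–Shub 1977, §5, discrete version; Chicone 1999 §4.1).

## References

* D. Henry, *Geometric Theory of Semilinear Parabolic Equations*, LNM 840, Springer 1981,
  Thm. 5.2.1 and its proof (Lyapunov–Perron method for maps). [Henry1981]
-/

noncomputable section

open _root_.Filter _root_.Topology Finset

namespace Literature.Analysis.OperatorTheory

variable {X : Type*} [NormedAddCommGroup X] [NormedSpace ℂ X]

/-- On the antidiagonal `i + j = n`: `aⁱ γʲ = (a/γ)ⁱ γⁿ`. [folklore] -/
theorem pow_mul_pow_eq_of_mem_antidiagonal {a γ : ℝ} (hγ : γ ≠ 0) {n : ℕ} {p : ℕ × ℕ}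
    (hp : p ∈ antidiagonal n) : a ^ p.1 * γ ^ p.2 = (a / γ) ^ p.1 * γ ^ n := by
  rw [mem_antidiagonal] at hp
  rw [← hp, pow_add, div_pow]
  field_simp

/-- Partial geometric sums over the antidiagonal are bounded by the full series:
`∑_{i+j=n} qⁱ ≤ (1 − q)⁻¹` for `0 ≤ q < 1`. [folklore] -/
theorem sum_antidiagonal_pow_le {q : ℝ} (hq0 : 0 ≤ q) (hq1 : q < 1) (n : ℕ) :
    ∑ p ∈ antidiagonal n, q ^ p.1 ≤ (1 - q)⁻¹ := by
  rw [Nat.sum_antidiagonal_eq_sum_range_succ (fun i _ => q ^ i) n, ← tsum_geometric_of_lt_one hq0 hq1]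
  exact (summable_geometric_of_lt_one hq0 hq1).sum_le_tsum _ fun i _ => pow_nonneg hq0 i

/-- **The stable Lyapunov–Perron sum.** If `‖mⁱ P‖ ≤ C aⁱ`, `0 ≤ a < γ` and `‖g j‖ ≤ t γʲ` for
all `j`, then `‖∑_{i+j=n} (mⁱ P)(g j)‖ ≤ C (1 − a/γ)⁻¹ t γⁿ`. [cite: Henry1981, Thm. 5.2.1 (proof)] -/
theorem norm_sum_antidiagonal_le {m P : X →L[ℂ] X} {C a γ t : ℝ} (ha : 0 ≤ a) (haγ : a < γ)
    (ht : 0 ≤ t) (hPn : ∀ n : ℕ, ‖m ^ n * P‖ ≤ C * a ^ n) {g : ℕ → X}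
    (hg : ∀ k, ‖g k‖ ≤ t * γ ^ k) (n : ℕ) :
    ‖∑ p ∈ antidiagonal n, (m ^ p.1 * P) (g p.2)‖ ≤ C * (1 - a / γ)⁻¹ * t * γ ^ n := by
  have hγ : 0 < γ := ha.trans_lt haγ
  have hC : 0 ≤ C := by
    have h := hPn 0; rw [pow_zero, pow_zero, mul_one, one_mul] at h; exact (norm_nonneg _).trans h
  have hq0 : 0 ≤ a / γ := div_nonneg ha hγ.le
  have hq1 : a / γ < 1 := (div_lt_one hγ).2 haγ
  calc ‖∑ p ∈ antidiagonal n, (m ^ p.1 * P) (g p.2)‖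
      ≤ ∑ p ∈ antidiagonal n, ‖(m ^ p.1 * P) (g p.2)‖ := norm_sum_le _ _
    _ ≤ ∑ p ∈ antidiagonal n, C * t * γ ^ n * (a / γ) ^ p.1 := by
        refine sum_le_sum fun p hp => ?_
        calc ‖(m ^ p.1 * P) (g p.2)‖ ≤ ‖m ^ p.1 * P‖ * ‖g p.2‖ := (m ^ p.1 * P).le_opNorm _
          _ ≤ (C * a ^ p.1) * (t * γ ^ p.2) :=
              mul_le_mul (hPn _) (hg _) (norm_nonneg _) ((norm_nonneg _).trans (hPn _))
          _ = C * t * (a ^ p.1 * γ ^ p.2) := by ring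
          _ = C * t * γ ^ n * (a / γ) ^ p.1 := by
              rw [pow_mul_pow_eq_of_mem_antidiagonal hγ.ne' hp]; ring
    _ = C * t * γ ^ n * ∑ p ∈ antidiagonal n, (a / γ) ^ p.1 := by rw [mul_sum]
    _ ≤ C * t * γ ^ n * (1 - a / γ)⁻¹ :=
        mul_le_mul_of_nonneg_left (sum_antidiagonal_pow_le hq0 hq1 n)
          (mul_nonneg (mul_nonneg hC ht) (pow_nonneg hγ.le n))
    _ = C * (1 - a / γ)⁻¹ * t * γ ^ n := by ring

/-- Termwise bound for the unstable tail: `‖(J (i+1) Q)(g (k+i))‖ ≤ (C² b⁻¹ t γᵏ) (γ/b)ⁱ`.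
[cite: Henry1981, Thm. 5.2.1 (proof)] -/
theorem norm_backward_term_le {J : ℕ → X →L[ℂ] X} {Q : X →L[ℂ] X} {C b γ t : ℝ} (hγ : 0 ≤ γ)
    (hγb : γ < b) (ht : 0 ≤ t) (hJn : ∀ n : ℕ, ‖J n‖ * b ^ n ≤ C) (hQ : ‖Q‖ ≤ C) {g : ℕ → X}
    (hg : ∀ k, ‖g k‖ ≤ t * γ ^ k) (k i : ℕ) :
    ‖(J (i + 1) * Q) (g (k + i))‖ ≤ C ^ 2 * b⁻¹ * t * γ ^ k * (γ / b) ^ i := by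
  have hb : 0 < b := hγ.trans_lt hγb
  have hC : 0 ≤ C := (norm_nonneg _).trans hQ
  have hJi : ‖J (i + 1)‖ ≤ C / b ^ (i + 1) := by
    rw [le_div_iff₀ (pow_pos hb _)]; exact hJn _
  calc ‖(J (i + 1) * Q) (g (k + i))‖ ≤ ‖J (i + 1) * Q‖ * ‖g (k + i)‖ := (J (i + 1) * Q).le_opNorm _
    _ ≤ (‖J (i + 1)‖ * ‖Q‖) * (t * γ ^ (k + i)) :=
        mul_le_mul (norm_mul_le _ _) (hg _) (norm_nonneg _)
          (mul_nonneg (norm_nonneg _) (norm_nonneg _))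
    _ ≤ (C / b ^ (i + 1) * C) * (t * γ ^ (k + i)) :=
        mul_le_mul_of_nonneg_right (mul_le_mul hJi hQ (norm_nonneg _)
          (div_nonneg hC (pow_nonneg hb.le _))) (mul_nonneg ht (pow_nonneg hγ _))
    _ = C ^ 2 * b⁻¹ * t * γ ^ k * (γ / b) ^ i := by
        rw [pow_add, pow_succ, div_pow]; field_simp; ring

/-- **The unstable Lyapunov–Perron tail is summable** when `‖J n‖ bⁿ ≤ C`, `‖Q‖ ≤ C`,
`0 ≤ γ < b` and `‖g j‖ ≤ t γʲ`. [cite: Henry1981, Thm. 5.2.1 (proof)] -/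
theorem summable_backward_tail [CompleteSpace X] {J : ℕ → X →L[ℂ] X} {Q : X →L[ℂ] X}
    {C b γ t : ℝ} (hγ : 0 ≤ γ) (hγb : γ < b) (ht : 0 ≤ t) (hJn : ∀ n : ℕ, ‖J n‖ * b ^ n ≤ C)
    (hQ : ‖Q‖ ≤ C) {g : ℕ → X} (hg : ∀ k, ‖g k‖ ≤ t * γ ^ k) (k : ℕ) :
    Summable fun i : ℕ => (J (i + 1) * Q) (g (k + i)) := by
  have hb : 0 < b := hγ.trans_lt hγb
  refine Summable.of_norm_bounded (g := fun i : ℕ => C ^ 2 * b⁻¹ * t * γ ^ k * (γ / b) ^ i) ?_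
    (fun i => norm_backward_term_le hγ hγb ht hJn hQ hg k i)
  exact (summable_geometric_of_lt_one (div_nonneg hγ hb.le) ((div_lt_one hb).2 hγb)).mul_left _

/-- **The unstable Lyapunov–Perron sum**: under the same hypotheses,
`‖∑' i, (J (i+1) Q)(g (k+i))‖ ≤ C² b⁻¹ (1 − γ/b)⁻¹ t γᵏ`. [cite: Henry1981, Thm. 5.2.1 (proof)] -/
theorem norm_tsum_backward_tail_le [CompleteSpace X] {J : ℕ → X →L[ℂ] X} {Q : X →L[ℂ] X}
    {C b γ t : ℝ} (hγ : 0 ≤ γ) (hγb : γ < b) (ht : 0 ≤ t) (hJn : ∀ n : ℕ, ‖J n‖ * b ^ n ≤ C)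
    (hQ : ‖Q‖ ≤ C) {g : ℕ → X} (hg : ∀ k, ‖g k‖ ≤ t * γ ^ k) (k : ℕ) :
    ‖∑' i : ℕ, (J (i + 1) * Q) (g (k + i))‖ ≤ C ^ 2 * b⁻¹ * (1 - γ / b)⁻¹ * t * γ ^ k := by
  have hb : 0 < b := hγ.trans_lt hγb
  have hq0 : 0 ≤ γ / b := div_nonneg hγ hb.le
  have hq1 : γ / b < 1 := (div_lt_one hb).2 hγb
  have hgeom := summable_geometric_of_lt_one hq0 hq1
  calc ‖∑' i : ℕ, (J (i + 1) * Q) (g (k + i))‖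
      ≤ ∑' i : ℕ, C ^ 2 * b⁻¹ * t * γ ^ k * (γ / b) ^ i :=
        tsum_of_norm_bounded (hgeom.mul_left _).hasSum
          (fun i => norm_backward_term_le hγ hγb ht hJn hQ hg k i)
    _ = C ^ 2 * b⁻¹ * t * γ ^ k * (1 - γ / b)⁻¹ := by
        rw [tsum_mul_left, tsum_geometric_of_lt_one hq0 hq1]
    _ = C ^ 2 * b⁻¹ * (1 - γ / b)⁻¹ * t * γ ^ k := by ring

/-- **Shift identity for the unstable tail**: if `m J (i+1) = J i` for all `i` and `J 0 = Q` with
`Q² = Q`, then `m (∑' i, (J (i+1) Q)(g (k+i))) = Q (Q (g k)) + ∑' i, (J (i+1) Q)(g (k+1+i))`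
(apply `m` termwise and split off the `i = 0` term). [cite: Henry1981, Thm. 5.2.1 (proof)] -/
theorem map_tsum_backward_tail [CompleteSpace X] {m Q : X →L[ℂ] X} {J : ℕ → X →L[ℂ] X}
    (hJ0 : J 0 = Q) (hJ : ∀ n, m * J (n + 1) = J n) {g : ℕ → X} (k : ℕ)
    (hs : Summable fun i : ℕ => (J (i + 1) * Q) (g (k + i)))
    (hs' : Summable fun i : ℕ => (J (i + 1) * Q) (g (k + 1 + i))) :
    m (∑' i : ℕ, (J (i + 1) * Q) (g (k + i))) =
      Q (Q (g k)) + ∑' i : ℕ, (J (i + 1) * Q) (g (k + 1 + i)) := by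
  have h1 : (fun i : ℕ => m ((J (i + 1) * Q) (g (k + i)))) = fun i => (J i * Q) (g (k + i)) := by
    funext i
    rw [← mul_apply_eq_comp, ← mul_assoc, hJ i]
  rw [ContinuousLinearMap.map_tsum m hs, h1]
  have hs'' : Summable fun i : ℕ => (J i * Q) (g (k + i)) := by
    rw [← summable_nat_add_iff 1]
    convert hs' using 1
    funext i
    simp only [add_assoc, add_comm 1 i]
  rw [hs''.tsum_eq_zero_add]
  congr 1
  · rw [hJ0, add_zero, mul_apply_eq_comp]
  · refine tsum_congr fun i => ?_
    congr 2; omega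

end Literature.Analysis.OperatorTheory
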